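import Literature.Analysis.FluidPDE.PassiveVectorTensorModalAdjointField
import HarnessLib

/-!
# Finite-mode SUPERPOSITION of modal adjoint fields: the classical backward adjoint solution of the
# constant-tensor passive-vector operator from a real vector trigonometric polynomial

Analysis/FluidPDE support file (definitions + proved lemmas; no named facts), continuation of
`PassiveVectorTensorModalAdjointCoeff` / `…ModalAdjointField` (one wave vector).  For a finite
frequency set `S` and a coefficient family `ŷ` (transversal: `k · ŷ k = 0`, `0 ∉ S`) the field
`φ τ := realTrigPoly S (k ↦ c_k(τ))`, `c_k(τ) = exp((τ − t) L_k) (ŷ k)`, is the sum over `k ∈ S` of the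
modal adjoint fields; by linearity it has the same test-class regularity (smooth slices, all iterated
space derivatives jointly continuous, Lipschitz on `[0,T]` uniformly in space, an everywhere time
derivative, divergence-free slices), the terminal value `φ t = realTrigPoly S ŷ`, the sup bound
`‖φ τ y‖ ≤ Σ_k ‖c_k τ‖ (≤ Σ_k ‖ŷ k‖ for τ ≤ t in a Legendre–Hadamard window)`, and it solves the backward
adjoint problem CLASSICALLY: `φ′ τ y + 𝓛_𝔸^*(φ τ) y = ∇(q τ) y` with the explicit trigonometric pressure.
This is the Galerkin-type (finitely many Fourier modes) classical solution of the adjoint parabolic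
problem used in transposition / duality arguments (Lions–Magenes Ch. 3 §4.3; the real Galerkin fields of
Robinson–Rodrigo–Sadowski §4.1), here serving as the all-modes test for ENERGY-form duality bounds.

Consumer: cell `ad-ideate`, K1L_D `stmt-AnomalousDissipation-27980`, S23‴ sub-stub W3-E (energy-form
surviving-energy bound by duality, tenure D25-7) and the (E_G⁺) band facts (`S` = a band of labels).

## Mathlib / tree search
Tree: `realTrigPoly` API (`realTrigPoly_apply_eq_sum`, `norm_realTrigPoly_apply_le`, `iterPartialDeriv_realTrigPoly`,
`isDivFree_realTrigPoly`, `partialDeriv_realTrigPoly'`, `partialDeriv_re_trigPoly`, `gradient_eq_sum_partialDeriv`),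
`viscAdj_add_field`/`viscAdj_zero_field`, the one-mode files (`modalAdjCoeff/Gen/Field/GradCoeff`, `modalAdjGen_sub_symbT`).
No multi-mode adjoint field existed.

## References
* J.-L. Lions, E. Magenes, *Non-Homogeneous Boundary Value Problems* I (Springer 1972), Ch. 3 §4.3. [`LionsMagenes1972`]
* J. C. Robinson, J. L. Rodrigo, W. Sadowski, *The Three-Dimensional Navier–Stokes Equations* (CUP 2016), §4.1 (real Galerkin fields). [`RobinsonRodrigoSadowski2016`]
* U. Frisch, *Turbulence* (CUP 1995), §9.6.3 eq. (9.57) p. 233. [`Frisch1995Turbulence`]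
-/

noncomputable section

open MeasureTheory Set Filter Complex
open scoped InnerProductSpace ComplexConjugate NNReal

namespace Literature.Analysis.FluidPDE

namespace Torus

variable {d : Type*} [Fintype d] [DecidableEq d]

open FunctionSpaces FunctionSpaces.Torus UnitAddTorus

/-! ## §1 `𝓛_𝔸^*` on a real vector trigonometric polynomial (finite frequency set) -/

/-- `viscAdj 𝔸` is additive over finite sums of smooth fields, and the sum is smooth. [cite: Frisch1995Turbulence, §9.6.3 eq. (9.57) p. 233] -/
theorem viscAdj_finset_sum {ι : Type*} (𝔸 : Visc4 d) (s : Finset ι)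
    {f : ι → UnitAddTorus d → EuclideanSpace ℝ d} (hf : ∀ i, IsSmooth (f i)) :
    IsSmooth (fun y => ∑ i ∈ s, f i y) ∧
      ∀ x, viscAdj 𝔸 (fun y => ∑ i ∈ s, f i y) x = ∑ i ∈ s, viscAdj 𝔸 (f i) x := by
  classical
  induction s using Finset.induction_on with
  | empty =>
    refine ⟨?_, fun x => ?_⟩
    · simp only [Finset.sum_empty]
      exact (contDiff_const : ContDiff ℝ _ fun _ : EuclideanSpace ℝ d => (0 : EuclideanSpace ℝ d))
    · simp only [Finset.sum_empty]
      exact viscAdj_zero_field 𝔸 x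
  | insert a s ha ih =>
    have e : (fun y => ∑ i ∈ insert a s, f i y) = f a + fun y => ∑ i ∈ s, f i y := by
      funext y; rw [Finset.sum_insert ha]; rfl
    refine ⟨?_, fun x => ?_⟩
    · rw [e]; exact (hf a).add ih.1
    · rw [e, viscAdj_add_field 𝔸 (hf a) ih.1 x, ih.2 x, Finset.sum_insert ha]

omit [DecidableEq d] in
/-- A real vector trigonometric polynomial as the sum of its single real modes (function form; private twin of
`PassiveVectorTensorBlockIdentity.realTrigPoly_eq_sum_singleton`, not imported here). [folklore] -/
private theorem realTrigPoly_eq_sum_singleton' (S : Finset (d → ℤ)) (c : (d → ℤ) → EuclideanSpace ℂ d) :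
    realTrigPoly S c = fun y => ∑ k ∈ S, realTrigPoly {k} c y := by
  funext y
  rw [realTrigPoly_apply_eq_sum]
  exact Finset.sum_congr rfl fun k _ => (realTrigPoly_singleton_apply k c y).symm

/-- **`𝓛_𝔸^*` of a real vector trigonometric polynomial**: every plane wave is mapped by the symbol,
`𝓛_𝔸^* Re Σ_k e_k • c_k = Re Σ_k e_k • (−4π²) T_𝔸(k) c_k`. [cite: Frisch1995Turbulence, §9.6.3 eq. (9.57) p. 233] -/
theorem viscAdj_realTrigPoly (𝔸 : Visc4 d) (S : Finset (d → ℤ)) (c : (d → ℤ) → EuclideanSpace ℂ d) (x : UnitAddTorus d) :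
    viscAdj 𝔸 (realTrigPoly S c) x =
      realTrigPoly S (fun k => (-(4 * Real.pi ^ 2 : ℝ) : ℂ) • symbT 𝔸 k (c k)) x := by
  rw [realTrigPoly_eq_sum_singleton' S c, (viscAdj_finset_sum 𝔸 S (fun k => isSmooth_realTrigPoly {k} c)).2 x,
    realTrigPoly_apply_eq_sum]
  refine Finset.sum_congr rfl fun k _ => ?_
  rw [viscAdj_realTrigPoly_singleton, realTrigPoly_singleton_apply]

/-! ## §2 The multi-mode adjoint field -/

/-- **The multi-mode adjoint field** with terminal value `realTrigPoly S ŷ` at time `t`: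
`φ τ = Re Σ_{k∈S} e_k • c_k(τ)`, `c_k(τ) = exp((τ − t) L_k) (ŷ k)`. [cite: LionsMagenes1972, Ch. 3 §4.3] -/
def multiAdjField (𝔸 : Visc4 d) (S : Finset (d → ℤ)) (t : ℝ) (ŷ : (d → ℤ) → EuclideanSpace ℂ d) :
    ℝ → UnitAddTorus d → EuclideanSpace ℝ d :=
  fun τ => realTrigPoly S (fun k => modalAdjCoeff 𝔸 k t (ŷ k) τ)

/-- Its time derivative `φ′ τ = Re Σ_k e_k • L_k c_k(τ)`. [cite: LionsMagenes1972, Ch. 3 §4.3] -/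
def multiAdjFieldDeriv (𝔸 : Visc4 d) (S : Finset (d → ℤ)) (t : ℝ) (ŷ : (d → ℤ) → EuclideanSpace ℂ d) :
    ℝ → UnitAddTorus d → EuclideanSpace ℝ d :=
  fun τ => realTrigPoly S (fun k => modalAdjGen 𝔸 k (modalAdjCoeff 𝔸 k t (ŷ k) τ))

/-- The multi-mode pressure `q τ = Re Σ_k e_k · g_k(τ)/(2πi)`. [cite: LionsMagenes1972, Ch. 3 §4.3] -/
def multiAdjPressure (𝔸 : Visc4 d) (S : Finset (d → ℤ)) (t : ℝ) (ŷ : (d → ℤ) → EuclideanSpace ℂ d) :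
    ℝ → UnitAddTorus d → ℝ :=
  fun τ y => (trigPoly S (fun k => (2 * Real.pi * Complex.I)⁻¹ * modalAdjGradCoeff 𝔸 k t (ŷ k) τ) y).re

omit [DecidableEq d] in
/-- The multi-mode field is the sum of the one-mode fields. [cite: LionsMagenes1972, Ch. 3 §4.3] -/
theorem multiAdjField_apply_eq_sum (𝔸 : Visc4 d) (S : Finset (d → ℤ)) (t : ℝ) (ŷ : (d → ℤ) → EuclideanSpace ℂ d)
    (τ : ℝ) (y : UnitAddTorus d) :
    multiAdjField 𝔸 S t ŷ τ y = ∑ k ∈ S, modalAdjField 𝔸 k t (ŷ k) τ y := by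
  rw [multiAdjField, realTrigPoly_apply_eq_sum]
  exact Finset.sum_congr rfl fun k _ => (modalAdjField_apply 𝔸 k t (ŷ k) τ y).symm

omit [DecidableEq d] in
/-- Terminal slice: `φ t = realTrigPoly S ŷ`. [cite: LionsMagenes1972, Ch. 3 §4.3] -/
theorem multiAdjField_self (𝔸 : Visc4 d) (S : Finset (d → ℤ)) (t : ℝ) (ŷ : (d → ℤ) → EuclideanSpace ℂ d) :
    multiAdjField 𝔸 S t ŷ t = realTrigPoly S ŷ := by
  rw [multiAdjField]
  exact realTrigPoly_congr fun k _ => modalAdjCoeff_self 𝔸 k t (ŷ k)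

omit [DecidableEq d] in
/-- Smooth slices. [cite: LionsMagenes1972, Ch. 3 §4.3] -/
theorem isSmooth_multiAdjField (𝔸 : Visc4 d) (S : Finset (d → ℤ)) (t : ℝ) (ŷ : (d → ℤ) → EuclideanSpace ℂ d) (τ : ℝ) :
    IsSmooth (multiAdjField 𝔸 S t ŷ τ) :=
  isSmooth_realTrigPoly _ _

/-- Iterated space derivatives of the slices. [cite: LionsMagenes1972, Ch. 3 §4.3] -/
theorem iterPartialDeriv_multiAdjField (𝔸 : Visc4 d) (S : Finset (d → ℤ)) (t : ℝ) (ŷ : (d → ℤ) → EuclideanSpace ℂ d)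
    (l : List d) (τ : ℝ) :
    iterPartialDeriv l (multiAdjField 𝔸 S t ŷ τ) =
      realTrigPoly S (fun k => derivMultiplier l k • modalAdjCoeff 𝔸 k t (ŷ k) τ) := by
  rw [multiAdjField, iterPartialDeriv_realTrigPoly]

/-- **Joint continuity of all iterated space derivatives** in `(τ, y)`. [cite: LionsMagenes1972, Ch. 3 §4.3] -/
theorem continuous_uncurry_iterPartialDeriv_multiAdjField (𝔸 : Visc4 d) (S : Finset (d → ℤ)) (t : ℝ)
    (ŷ : (d → ℤ) → EuclideanSpace ℂ d) (l : List d) :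
    Continuous (Function.uncurry fun τ y => iterPartialDeriv l (multiAdjField 𝔸 S t ŷ τ) y) := by
  have e : (Function.uncurry fun τ y => iterPartialDeriv l (multiAdjField 𝔸 S t ŷ τ) y) =
      fun p : ℝ × UnitAddTorus d => ∑ k ∈ S,
        EuclideanSpace.realPart (mFourier k p.2 • (derivMultiplier l k • modalAdjCoeff 𝔸 k t (ŷ k) p.1)) := by
    funext p
    rw [Function.uncurry_apply_pair, iterPartialDeriv_multiAdjField, realTrigPoly_apply_eq_sum]
  rw [e]
  refine continuous_finsetSum S fun k _ => ?_
  refine (EuclideanSpace.realPart (ι := d)).continuous.comp ?_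
  exact ((mFourier k).continuous.comp continuous_snd).smul
    (((continuous_modalAdjCoeff 𝔸 k t (ŷ k)).comp continuous_fst).const_smul (derivMultiplier l k))

omit [DecidableEq d] in
/-- Joint continuity of the field. [cite: LionsMagenes1972, Ch. 3 §4.3] -/
theorem continuous_uncurry_multiAdjField (𝔸 : Visc4 d) (S : Finset (d → ℤ)) (t : ℝ) (ŷ : (d → ℤ) → EuclideanSpace ℂ d) :
    Continuous (Function.uncurry (multiAdjField 𝔸 S t ŷ)) := by
  have e : Function.uncurry (multiAdjField 𝔸 S t ŷ) =
      fun p : ℝ × UnitAddTorus d => ∑ k ∈ S, modalAdjField 𝔸 k t (ŷ k) p.1 p.2 := by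
    funext p; rw [Function.uncurry_apply_pair, multiAdjField_apply_eq_sum]
  rw [e]
  exact continuous_finsetSum S fun k _ =>
    (continuous_uncurry_modalAdjField 𝔸 k t (ŷ k)).comp (continuous_fst.prodMk continuous_snd)

omit [DecidableEq d] in
/-- **Time derivative at every point**: `HasDerivAt (φ · y) (φ′ τ y) τ`. [cite: LionsMagenes1972, Ch. 3 §4.3] -/
theorem hasDerivAt_multiAdjField (𝔸 : Visc4 d) (S : Finset (d → ℤ)) (t : ℝ) (ŷ : (d → ℤ) → EuclideanSpace ℂ d)
    (τ : ℝ) (y : UnitAddTorus d) :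
    HasDerivAt (fun s => multiAdjField 𝔸 S t ŷ s y) (multiAdjFieldDeriv 𝔸 S t ŷ τ y) τ := by
  have e1 : (fun s => multiAdjField 𝔸 S t ŷ s y) = fun s => ∑ k ∈ S, modalAdjField 𝔸 k t (ŷ k) s y := by
    funext s; rw [multiAdjField_apply_eq_sum]
  have e2 : multiAdjFieldDeriv 𝔸 S t ŷ τ y = ∑ k ∈ S, modalAdjFieldDeriv 𝔸 k t (ŷ k) τ y := by
    rw [multiAdjFieldDeriv, realTrigPoly_apply_eq_sum]
    exact Finset.sum_congr rfl fun k _ => by rw [modalAdjFieldDeriv, realTrigPoly_singleton_apply]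
  rw [e1, e2]
  have h := HasDerivAt.sum (u := S) (A := fun k s => modalAdjField 𝔸 k t (ŷ k) s y)
    (A' := fun k => modalAdjFieldDeriv 𝔸 k t (ŷ k) τ y) (x := τ) fun k _ => hasDerivAt_modalAdjField 𝔸 k t (ŷ k) τ y
  have e3 : (fun s => ∑ k ∈ S, modalAdjField 𝔸 k t (ŷ k) s y) = ∑ k ∈ S, fun s => modalAdjField 𝔸 k t (ŷ k) s y := by
    funext s; simp [Finset.sum_apply]
  rw [e3]
  exact h

omit [DecidableEq d] in
/-- **Lipschitz in time, uniformly in space**, on every `[0,T]`. [cite: LionsMagenes1972, Ch. 3 §4.3] -/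
theorem exists_lipschitz_multiAdjField (𝔸 : Visc4 d) (S : Finset (d → ℤ)) (t : ℝ) (ŷ : (d → ℤ) → EuclideanSpace ℂ d) (T : ℝ) :
    ∃ L : ℝ, 0 ≤ L ∧ ∀ τ ∈ Icc (0:ℝ) T, ∀ s ∈ Icc (0:ℝ) T, ∀ y,
      ‖multiAdjField 𝔸 S t ŷ τ y - multiAdjField 𝔸 S t ŷ s y‖ ≤ L * |τ - s| := by
  classical
  choose L hL0 hL using fun k : d → ℤ => exists_lipschitz_modalAdjField 𝔸 k t (ŷ k) T
  refine ⟨∑ k ∈ S, L k, Finset.sum_nonneg fun k _ => hL0 k, fun τ hτ s hs y => ?_⟩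
  rw [multiAdjField_apply_eq_sum, multiAdjField_apply_eq_sum, ← Finset.sum_sub_distrib, Finset.sum_mul]
  exact (norm_sum_le _ _).trans (Finset.sum_le_sum fun k _ => hL k τ hτ s hs y)

omit [DecidableEq d] in
/-- Transversality of the coefficient family at every time (`0 ∉ S`, `k · ŷ k = 0` on `S`). [cite: RobinsonRodrigoSadowski2016, Def. 2.1] -/
theorem isTransversal_multiAdjCoeff (𝔸 : Visc4 d) {S : Finset (d → ℤ)} (hS : ∀ k ∈ S, k ≠ 0) (t : ℝ)
    {ŷ : (d → ℤ) → EuclideanSpace ℂ d} (hŷ : ∀ k ∈ S, kdot k (ŷ k) = 0) (τ : ℝ) :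
    IsTransversal S (fun k => modalAdjCoeff 𝔸 k t (ŷ k) τ) :=
  fun k hk => kdot_modalAdjCoeff 𝔸 (hS k hk) t (hŷ k hk) τ

/-- **Divergence-free slices** (`0 ∉ S`, transversal `ŷ`). [cite: RobinsonRodrigoSadowski2016, Def. 2.1] -/
theorem isDivFree_multiAdjField (𝔸 : Visc4 d) {S : Finset (d → ℤ)} (hS : ∀ k ∈ S, k ≠ 0) (t : ℝ)
    {ŷ : (d → ℤ) → EuclideanSpace ℂ d} (hŷ : ∀ k ∈ S, kdot k (ŷ k) = 0) (τ : ℝ) :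
    IsDivFree (multiAdjField 𝔸 S t ŷ τ) :=
  isDivFree_realTrigPoly (isTransversal_multiAdjCoeff 𝔸 hS t hŷ τ)

omit [DecidableEq d] in
/-- Sup bound by the coefficients: `‖φ τ y‖ ≤ Σ_k ‖c_k τ‖`. [cite: RobinsonRodrigoSadowski2016, §4.1] -/
theorem norm_multiAdjField_le (𝔸 : Visc4 d) (S : Finset (d → ℤ)) (t : ℝ) (ŷ : (d → ℤ) → EuclideanSpace ℂ d)
    (τ : ℝ) (y : UnitAddTorus d) :
    ‖multiAdjField 𝔸 S t ŷ τ y‖ ≤ ∑ k ∈ S, ‖modalAdjCoeff 𝔸 k t (ŷ k) τ‖ :=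
  norm_realTrigPoly_apply_le S _ y

omit [DecidableEq d] in
/-- In a window `NearIso 𝔸 lo hi` with `lo ≥ 0`, for transversal `ŷ`, `0 ∉ S` and `τ ≤ t`:
`‖φ τ y‖ ≤ Σ_k ‖ŷ k‖`. [cite: LionsMagenes1972, Ch. 3 §4.3] -/
theorem norm_multiAdjField_le_of_le {𝔸 : Visc4 d} {lo hi : ℝ} (h𝔸 : NearIso 𝔸 lo hi) (hlo : 0 ≤ lo)
    {S : Finset (d → ℤ)} (hS : ∀ k ∈ S, k ≠ 0) (t : ℝ) {ŷ : (d → ℤ) → EuclideanSpace ℂ d}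
    (hŷ : ∀ k ∈ S, kdot k (ŷ k) = 0) {τ : ℝ} (hτ : τ ≤ t) (y : UnitAddTorus d) :
    ‖multiAdjField 𝔸 S t ŷ τ y‖ ≤ ∑ k ∈ S, ‖ŷ k‖ :=
  (norm_multiAdjField_le 𝔸 S t ŷ τ y).trans
    (Finset.sum_le_sum fun k hk => norm_modalAdjCoeff_le h𝔸 hlo (hS k hk) t (hŷ k hk) hτ)

/-! ## §3 The pointwise adjoint identity for the multi-mode field -/

omit [DecidableEq d] in
/-- The multi-mode pressure is smooth. [cite: LionsMagenes1972, Ch. 3 §4.3] -/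
theorem isSmooth_multiAdjPressure (𝔸 : Visc4 d) (S : Finset (d → ℤ)) (t : ℝ) (ŷ : (d → ℤ) → EuclideanSpace ℂ d) (τ : ℝ) :
    IsSmooth (multiAdjPressure 𝔸 S t ŷ τ) :=
  isSmooth_re_trigPoly _ _

/-- Gradient of the multi-mode pressure: `∇q τ = Re Σ_k e_k • g_k(τ) k`. [cite: LionsMagenes1972, Ch. 3 §4.3] -/
theorem gradient_multiAdjPressure (𝔸 : Visc4 d) (S : Finset (d → ℤ)) (t : ℝ) (ŷ : (d → ℤ) → EuclideanSpace ℂ d)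
    (τ : ℝ) (y : UnitAddTorus d) :
    gradient (multiAdjPressure 𝔸 S t ŷ τ) y =
      realTrigPoly S (fun k => modalAdjGradCoeff 𝔸 k t (ŷ k) τ • waveVecC k) y := by
  have h1 : IsContDiff 1 (multiAdjPressure 𝔸 S t ŷ τ) := (isSmooth_multiAdjPressure 𝔸 S t ŷ τ).isContDiff (by simp)
  rw [gradient_eq_sum_partialDeriv h1]
  ext j
  rw [WithLp.ofLp_sum, Finset.sum_apply, Finset.sum_eq_single j (fun i _ hij => by simp [hij]) (by simp)]
  have hq : FunctionSpaces.Torus.partialDeriv j (multiAdjPressure 𝔸 S t ŷ τ) y =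
      (∑ k ∈ S, mFourier k y • ((2 * Real.pi * Complex.I * (k j : ℂ)) •
        ((2 * Real.pi * Complex.I)⁻¹ * modalAdjGradCoeff 𝔸 k t (ŷ k) τ))).re := by
    have e : multiAdjPressure 𝔸 S t ŷ τ =
        fun y => (trigPoly S (fun k => (2 * Real.pi * Complex.I)⁻¹ * modalAdjGradCoeff 𝔸 k t (ŷ k) τ) y).re := rfl
    rw [e, partialDeriv_re_trigPoly, trigPoly_apply]
  rw [realTrigPoly_apply_coord, trigPoly_apply_coord]
  simp only [PiLp.smul_apply, smul_eq_mul, waveVecC_apply]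
  rw [show (EuclideanSpace.single j (1:ℝ)).ofLp j = 1 by simp, mul_one, hq, Complex.re_sum, Complex.re_sum]
  refine Finset.sum_congr rfl fun k _ => ?_
  congr 1
  have hI : (2 * (Real.pi : ℂ) * Complex.I) ≠ 0 := by simp [Real.pi_ne_zero, Complex.I_ne_zero]
  simp only [smul_eq_mul]
  field_simp

/-- **THE POINTWISE ADJOINT IDENTITY for the multi-mode field**: `φ′ τ y + 𝓛_𝔸^*(φ τ) y = ∇(q τ) y`.
[cite: LionsMagenes1972, Ch. 3 §4.3] [cite: Frisch1995Turbulence, §9.6.3 eq. (9.57) p. 233] -/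
theorem multiAdjFieldDeriv_add_viscAdj (𝔸 : Visc4 d) (S : Finset (d → ℤ)) (t : ℝ) (ŷ : (d → ℤ) → EuclideanSpace ℂ d)
    (τ : ℝ) (y : UnitAddTorus d) :
    multiAdjFieldDeriv 𝔸 S t ŷ τ y + viscAdj 𝔸 (multiAdjField 𝔸 S t ŷ τ) y =
      gradient (multiAdjPressure 𝔸 S t ŷ τ) y := by
  rw [gradient_multiAdjPressure, multiAdjField, viscAdj_realTrigPoly, multiAdjFieldDeriv,
    ← Pi.add_apply (realTrigPoly S _) (realTrigPoly S _) y, ← realTrigPoly_add]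
  refine congrFun (realTrigPoly_congr fun k _ => ?_) y
  rw [Pi.add_apply]
  exact modalAdjGen_sub_symbT 𝔸 k t (ŷ k) τ

end Torus

end Literature.Analysis.FluidPDE

end
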